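import Literature.AlgebraicGeometry.AbelianSchemes.IsogenyKernelReductionSurjective
import Mathlib.GroupTheory.Index
import HarnessLib

/-!
# Counting sections of the kernel of a generic isogeny: `#(Ker φ)⁰(R) · #(Ker φ)(κ) = deg φ_K` when all points are rational
# ([SerreTate1968] §1 Lemma 1; [Tate1997FiniteFlatGroupSchemes] (3.7); [BoschLutkebohmertRaynaud1990] §7.3 Prop. 6 (p. 180))

Topic `Literature/AlgebraicGeometry/AbelianSchemes`, namespace `Literature.AlgebraicGeometry.AbelianSchemes.AbelianSchemeOver`.  THEOREMS ONLY (no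
definition, no named fact, no instance, no notation, no `sorry`).  The COUNT clause of the DICT organ (o-c2l′) (F0P6c-plan (g0) 14:52:38Z «YES — (b4′)
`canonicalLine` needs exactly `#L₀ = #G₀(R) = kerRank φ_K ⁄ #(Ker φ)(κ̄)`»; cell `pub/hodgecm-mathlib`, P6 «MOD», door P″).  `R` a HENSELIAN Dedekind domain
(`𝒪_L`), `K = Frac R`, `φ : A → B` a generic isogeny of abelian schemes over `Spec R`, `G := Ker φ` (★ `GroupSchemeKernel.ker φ`) with a unit component
`j : G₀ ↪ G` (★ `exists_unitComponent`) and a presentation `eB : G ≅ Spec B`; IF all `kerRank φ_K` points of `G_K` are `K`-rational THEN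
`#G₀(R) · #G(κ(R)) = kerRank φ_K` (sections over `Spec R`, `κ(R)`-points over `Spec (residue R)`).  Proof: the reduction map `G(R) → G(κ)`, `s ↦ (Spec res) ≫ s`,
is a homomorphism of the groups of points (Mathlib `Hom.group`, `MonObj.comp_mul`), SURJECTIVE (★ (o-c2l′) `exists_section_ker_reduction_eq_of_card_points`)
with kernel `G₀(R)` (★ b1b `exists_section_factor_iff_reduction_eq_unit`; `j` is a monomorphism), and `#G(R) = #G(K) = kerRank φ_K` (★
`natCard_sections_ker_eq_natCard_points`); then `#ker · #image = #G(R)` (Mathlib `Subgroup.card_mul_index`, `Subgroup.index_ker`).  Generic capital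
`--supports stmt-HodgeConjecture-24832`.  HONEST LABEL: HC_CM is proved only modulo the cell's 2 remaining named inputs (hLiu418 24832, h413 24833) until rung 0
closes; this file pays no letter.

* **`natCard_sections_unitComponent_mul_natCard_points_eq_kerRank`** — the head displayed above.

## References
* [SerreTate1968] J.-P. Serre, J. Tate, *Good reduction of abelian varieties*, Ann. of Math. 88 (1968), §1 Lemma 1 (the reduction map on torsion points).
* [Tate1997FiniteFlatGroupSchemes] J. Tate, *Finite flat group schemes* (1997), (3.7) (connected–étale sequence; `|G| = |G⁰| · |G^{ét}|`).
* [BoschLutkebohmertRaynaud1990] S. Bosch, W. Lütkebohmert, M. Raynaud, *Néron Models* (1990), §7.3 Prop. 6 (p. 180).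
-/

set_option autoImplicit false

noncomputable section

universe u

open CategoryTheory CategoryTheory.Limits AlgebraicGeometry IsLocalRing MonoidalCategory CartesianMonoidalCategory
open scoped MonObj
open Literature.NumberTheory.EllipticCurves (specGenericPoint)
open Literature.AlgebraicGeometry.Motives (AbelianVariety)
open Literature.AlgebraicGeometry.GroupSchemes

namespace Literature.AlgebraicGeometry.AbelianSchemes

namespace AbelianSchemeOver

variable {R : Type u} [CommRing R] [IsDedekindDomain R] [HenselianLocalRing R] (K : Type u) [Field K] [Algebra R K]
  [IsFractionRing R K] {A B : AbelianSchemeOver (Spec (CommRingCat.of R))} (φ : A.X ⟶ B.X) [IsMonHom φ]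

/-- **`#(Ker φ)⁰(R) · #(Ker φ)(κ) = deg φ_K` when all `deg φ_K` points are `K`-rational** (`R` a henselian Dedekind domain): for any unit component
`j : G₀ ↪ Ker φ` (homomorphism, open and closed immersion, connected source) and any presentation `eB : Ker φ ≅ Spec B` over `Spec R`,
`Nat.card (𝟙_ ⟶ G₀) * Nat.card {κ(R)-points of Ker φ over Spec (residue R)} = kerRank φ_K`.  The reduction map on sections is a surjective (★ (o-c2l′))
homomorphism with kernel the sections of `G₀` (★ b1b), and `#(Ker φ)(R) = kerRank φ_K` (★ (o-c2l)). [cite: SerreTate1968, §1 Lemma 1]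
[cite: Tate1997FiniteFlatGroupSchemes, (3.7)] [cite: BoschLutkebohmertRaynaud1990, §7.3 Prop. 6 (p. 180)] -/
theorem natCard_sections_unitComponent_mul_natCard_points_eq_kerRank
    (hφ : AbelianVariety.IsIsogeny (fibreHom φ (specGenericPoint R K)))
    (B' : Type u) [CommRing B'] [Algebra R B'] (eB : (GroupSchemeKernel.ker φ).left ≅ Spec (CommRingCat.of B'))
    (heB : eB.hom ≫ Spec.map (CommRingCat.ofHom (algebraMap R B')) = (GroupSchemeKernel.ker φ).hom)
    (hK : Nat.card {t : Spec (CommRingCat.of K) ⟶ (GroupSchemeKernel.ker φ).left //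
        t ≫ (GroupSchemeKernel.ker φ).hom = Spec.map (CommRingCat.ofHom (algebraMap R K))} =
      AbelianVariety.Hom.kerRank (fibreHom φ (specGenericPoint R K)))
    (G₀ : Over (Spec (CommRingCat.of R))) [GrpObj G₀] (j : G₀ ⟶ GroupSchemeKernel.ker φ) [IsMonHom j] [IsOpenImmersion j.left]
    [IsClosedImmersion j.left] [ConnectedSpace ↥G₀.left] :
    Nat.card (𝟙_ (Over (Spec (CommRingCat.of R))) ⟶ G₀) *
        Nat.card {t₀ : Spec (CommRingCat.of (ResidueField R)) ⟶ (GroupSchemeKernel.ker φ).left //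
          t₀ ≫ (GroupSchemeKernel.ker φ).hom = Spec.map (CommRingCat.ofHom (residue R))} =
      AbelianVariety.Hom.kerRank (fibreHom φ (specGenericPoint R K)) := by
  haveI := isFinite_ker_hom K φ hφ
  -- the test object `T₀ = Spec κ(R)` over `Spec R` and the reduction homomorphism on points
  let T₀ : Over (Spec (CommRingCat.of R)) := Over.mk (Spec.map (CommRingCat.ofHom (residue R)))
  let r : T₀ ⟶ 𝟙_ (Over (Spec (CommRingCat.of R))) := Over.homMk (Spec.map (CommRingCat.ofHom (residue R))) (Category.comp_id _)
  let red : (𝟙_ (Over (Spec (CommRingCat.of R))) ⟶ GroupSchemeKernel.ker φ) →* (T₀ ⟶ GroupSchemeKernel.ker φ) :=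
    { toFun := fun s => r ≫ s
      map_one' := MonObj.comp_one r
      map_mul' := fun a b => MonObj.comp_mul r a b }
  have hr : ∀ s : 𝟙_ (Over (Spec (CommRingCat.of R))) ⟶ GroupSchemeKernel.ker φ,
      (red s).left = Spec.map (CommRingCat.ofHom (residue R)) ≫ s.left := fun s => rfl
  -- (a) `red` is surjective
  have hsurj : Function.Surjective red := by
    intro p
    have hp : p.left ≫ (GroupSchemeKernel.ker φ).hom = Spec.map (CommRingCat.ofHom ((RingHom.id _).comp (residue R))) := by
      rw [RingHom.id_comp]; exact Over.w p
    obtain ⟨s, hs⟩ := exists_section_ker_reduction_eq_of_card_points K φ hφ B' eB heB hK (RingHom.id _) p.left hp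
    refine ⟨s, Over.OverMorphism.ext ?_⟩
    rw [hr, ← hs, RingHom.id_comp]
  -- (b) the kernel of `red` is the image of the sections of `G₀`
  have hone : ∀ s : 𝟙_ (Over (Spec (CommRingCat.of R))) ⟶ GroupSchemeKernel.ker φ,
      red s = 1 ↔ Spec.map (CommRingCat.ofHom (residue R)) ≫ s.left =
        Spec.map (CommRingCat.ofHom (residue R)) ≫ (η[GroupSchemeKernel.ker φ] : 𝟙_ _ ⟶ _).left := by
    intro s
    constructor
    · intro h
      exact congrArg CommaMorphism.left h
    · intro h
      exact Over.OverMorphism.ext h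
  haveI : Mono j := Over.mono_of_mono_left j
  have hker : Nat.card red.ker = Nat.card (𝟙_ (Over (Spec (CommRingCat.of R))) ⟶ G₀) := by
    refine (Nat.card_congr (Equiv.ofBijective (fun s₀ : (𝟙_ (Over (Spec (CommRingCat.of R))) ⟶ G₀) =>
      (⟨s₀ ≫ j, ?_⟩ : red.ker)) ⟨fun a b h => ?_, fun s => ?_⟩)).symm
    · rw [MonoidHom.mem_ker, hone]
      exact (UnitComponent.exists_section_factor_iff_reduction_eq_unit R (GroupSchemeKernel.ker φ) G₀ j (s₀ ≫ j)).mp ⟨s₀, rfl⟩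
    · exact (cancel_mono j).mp (congrArg Subtype.val h)
    · have hs := (hone s.1).mp (MonoidHom.mem_ker.mp s.2)
      obtain ⟨s₀, hs₀⟩ := (UnitComponent.exists_section_factor_iff_reduction_eq_unit R (GroupSchemeKernel.ker φ) G₀ j s.1).mpr hs
      exact ⟨s₀, Subtype.ext hs₀⟩
  -- (c) `#sections = kerRank`, finite
  have hS : Nat.card (𝟙_ (Over (Spec (CommRingCat.of R))) ⟶ GroupSchemeKernel.ker φ) =
      AbelianVariety.Hom.kerRank (fibreHom φ (specGenericPoint R K)) := by
    rw [natCard_sections_ker_eq_natCard_points K φ hφ, hK]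
  haveI : IsFinite (AbelianVariety.Hom.toSchemeHom (fibreHom φ (specGenericPoint R K))) := hφ.2
  have hpos := AbelianVariety.Hom.kerRank_pos (fibreHom φ (specGenericPoint R K))
  haveI : Finite (𝟙_ (Over (Spec (CommRingCat.of R))) ⟶ GroupSchemeKernel.ker φ) :=
    Nat.finite_of_card_ne_zero (by rw [hS]; exact hpos.ne')
  -- (d) `#points = #range = index of the kernel`
  have hP : Nat.card {t₀ : Spec (CommRingCat.of (ResidueField R)) ⟶ (GroupSchemeKernel.ker φ).left //
        t₀ ≫ (GroupSchemeKernel.ker φ).hom = Spec.map (CommRingCat.ofHom (residue R))} =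
      Nat.card (T₀ ⟶ GroupSchemeKernel.ker φ) :=
    Nat.card_congr
      { toFun := fun t => Over.homMk t.1 t.2
        invFun := fun p => ⟨p.left, Over.w p⟩
        left_inv := fun t => rfl
        right_inv := fun p => rfl }
  have hrange : Nat.card red.range = Nat.card (T₀ ⟶ GroupSchemeKernel.ker φ) := by
    rw [MonoidHom.range_eq_top.mpr hsurj]
    exact Nat.card_congr Subgroup.topEquiv.toEquiv
  rw [hP, ← hrange, ← Subgroup.index_ker, ← hker, ← hS]
  exact Subgroup.card_mul_index red.ker

end AbelianSchemeOver

end Literature.AlgebraicGeometry.AbelianSchemes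

end
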